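import Mathlib
import Summits.NavierStokesRegularity.NavierStokesRegularity.Theorems.SymmetryModuliCountFarPastLedgerCovering
import Summits.NavierStokesRegularity.NavierStokesRegularity.Theorems.SymmetryModuliCountFarPastLedgerFarShell
import HarnessLib

/-!
# Slice pressure, tools for the large-scale averages (crux `FarPastLedger`, line `uloc-gronwall-transplant`)

Helper file for the lead's stub `stub_fplSlicePressure` of crux stmt-NavierStokesRegularity-14060
(`SymmetryModuliCount.FarPastLedger`): elementary real analysis for the scale-`r` bump averages
`θ_r(x) = θ(x/r)` of Mathlib's bump `θ` (`rIn = 1`, `rOut = 2` at the origin):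

* the smooth partition `η² + ζ² = 1` adapted to a ball (`fpl_exists_partition`);
* `∫ θ_r = r³ ∫ θ`, the `L²` scaling `∫ (∂ₑθ_r)² ≤ r ‖e‖² ∫ ‖Dθ‖²` (`fpl_integral_sq_fderiv_scaled_le`);
* `|∫ F G| ≤ √(∫F²) √(∫G²)` (`fpl_abs_integral_mul_le_sqrt`);
* the scaled far-shell tail `∫_{|y| ≥ 3r} ‖w‖² |y|⁻⁴ ≤ cS M² |B₁| / r` for `‖w‖ ≤ M`
  (`fpl_exists_farShell_scaled`, from the landed `stub_fplFarShell` by the substitution `y = rz`).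
-/

noncomputable section

open MeasureTheory Set Filter Metric Topology
open scoped ContDiff

set_option linter.dupNamespace false -- nested layout Summit.<S>.<Sub>, Sub = S (D-0017)

namespace Summit.NavierStokesRegularity.NavierStokesRegularity.Theorems

/-! ### The smooth partition adapted to a ball -/

/-- **A smooth partition `η² + ζ² = 1`** with `η = 0` off `B(c, 4R)` and `ζ = 0` on `B(c, 3R)`
(`η = sin(π f/2)`, `ζ = cos(π f/2)` for a bump `f` with `f = 1` on `B̄(c,3R)`, `supp f = B(c,4R)`). -/
theorem fpl_exists_partition (c : EuclideanSpace ℝ (Fin 3)) {R : ℝ} (hR : 0 < R) :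
    ∃ η ζ : EuclideanSpace ℝ (Fin 3) → ℝ, ContDiff ℝ ∞ η ∧ ContDiff ℝ ∞ ζ ∧
      (∀ y, η y ^ 2 + ζ y ^ 2 = 1) ∧ (∀ y ∉ ball c (4 * R), η y = 0) ∧
      (∀ y ∈ ball c (3 * R), ζ y = 0) := by
  let f : ContDiffBump c := ⟨3 * R, 4 * R, by positivity, by linarith⟩
  refine ⟨fun y => Real.sin (Real.pi / 2 * f y), fun y => Real.cos (Real.pi / 2 * f y), ?_, ?_,
    fun y => Real.sin_sq_add_cos_sq _, fun y hy => ?_, fun y hy => ?_⟩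
  · exact Real.contDiff_sin.comp (contDiff_const.mul f.contDiff)
  · exact Real.contDiff_cos.comp (contDiff_const.mul f.contDiff)
  · have : f y = 0 := f.zero_of_le_dist (by rw [mem_ball, not_lt] at hy; exact hy)
    simp [this]
  · have : f y = 1 := f.one_of_mem_closedBall (by
      rw [mem_closedBall]; rw [mem_ball] at hy; exact hy.le)
    show Real.cos (Real.pi / 2 * f y) = 0
    rw [this, mul_one, Real.cos_pi_div_two]

/-! ### Scalings of the bump -/

/-- `∫ θ(x/r) dx = r³ ∫ θ` for `r ≥ 0`. -/
theorem fpl_integral_bump_scaled {r : ℝ} (hr : 0 ≤ r) :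
    ∫ x, ((⟨1, 2, zero_lt_one, one_lt_two⟩ : ContDiffBump (0 : EuclideanSpace ℝ (Fin 3))) :
        EuclideanSpace ℝ (Fin 3) → ℝ) (r⁻¹ • x) =
      r ^ 3 * ∫ x, ((⟨1, 2, zero_lt_one, one_lt_two⟩ : ContDiffBump (0 : EuclideanSpace ℝ (Fin 3))) :
        EuclideanSpace ℝ (Fin 3) → ℝ) x := by
  rw [Measure.integral_comp_inv_smul_of_nonneg volume _ hr, finrank_euclideanSpace_fin, smul_eq_mul]

/-- The derivative of the scaled bump: `D(θ(·/r))(x) e = r⁻¹ Dθ(x/r) e`. -/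
theorem fpl_fderiv_bump_scaled {θ : EuclideanSpace ℝ (Fin 3) → ℝ} (hθ : Differentiable ℝ θ) (r : ℝ)
    (x e : EuclideanSpace ℝ (Fin 3)) :
    fderiv ℝ (fun y => θ (r⁻¹ • y)) x e = r⁻¹ * fderiv ℝ θ (r⁻¹ • x) e := by
  have h : HasFDerivAt (fun y : EuclideanSpace ℝ (Fin 3) => θ (r⁻¹ • y))
      ((fderiv ℝ θ (r⁻¹ • x)).comp (r⁻¹ • ContinuousLinearMap.id ℝ _)) x := by
    have h1 : HasFDerivAt (fun y : EuclideanSpace ℝ (Fin 3) => r⁻¹ • y)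
        (r⁻¹ • ContinuousLinearMap.id ℝ _) x := (hasFDerivAt_id x).const_smul r⁻¹
    exact (hθ (r⁻¹ • x)).hasFDerivAt.comp x h1
  rw [h.fderiv, ContinuousLinearMap.comp_apply, FunLike.coe_smul, Pi.smul_apply,
    ContinuousLinearMap.id_apply, map_smul, smul_eq_mul]

/-- **`L²` scaling of the derivative of the scaled bump**: for `θ ∈ C¹_c` and `r > 0`,
`∫ (D(θ(·/r))(x) e)² dx ≤ r ‖e‖² ∫ ‖Dθ‖²`. -/
theorem fpl_integral_sq_fderiv_scaled_le {θ : EuclideanSpace ℝ (Fin 3) → ℝ} (hθ : ContDiff ℝ 1 θ)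
    (hθc : HasCompactSupport θ) {r : ℝ} (hr : 0 < r) (e : EuclideanSpace ℝ (Fin 3)) :
    ∫ x, (fderiv ℝ (fun y => θ (r⁻¹ • y)) x e) ^ 2 ≤ r * ‖e‖ ^ 2 * ∫ z, ‖fderiv ℝ θ z‖ ^ 2 := by
  have hθd : Differentiable ℝ θ := hθ.differentiable one_ne_zero
  have hDc : Continuous (fderiv ℝ θ) := hθ.continuous_fderiv one_ne_zero
  have hs1 : HasCompactSupport (fderiv ℝ θ) := hθc.fderiv (𝕜 := ℝ)
  have hs2 : HasCompactSupport (fun z => ‖fderiv ℝ θ z‖ ^ 2) :=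
    hs1.norm.comp_left (g := fun t : ℝ => t ^ 2) (by norm_num)
  have hint : Integrable (fun z => ‖fderiv ℝ θ z‖ ^ 2) volume :=
    (hDc.norm.pow 2).integrable_of_hasCompactSupport hs2
  have e1 : (fun x => (fderiv ℝ (fun y => θ (r⁻¹ • y)) x e) ^ 2) =
      fun x => r⁻¹ ^ 2 * (fun z => (fderiv ℝ θ z e) ^ 2) (r⁻¹ • x) := by
    funext x
    rw [fpl_fderiv_bump_scaled hθd r x e, mul_pow]
  have e2 : ∫ x, (fun z => (fderiv ℝ θ z e) ^ 2) (r⁻¹ • x) = r ^ 3 * ∫ z, (fderiv ℝ θ z e) ^ 2 := by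
    rw [Measure.integral_comp_inv_smul_of_nonneg volume (fun z => (fderiv ℝ θ z e) ^ 2) hr.le,
      finrank_euclideanSpace_fin, smul_eq_mul]
  rw [e1, integral_const_mul, e2]
  have hpt : ∀ z, (fderiv ℝ θ z e) ^ 2 ≤ ‖e‖ ^ 2 * ‖fderiv ℝ θ z‖ ^ 2 := fun z => by
    rw [← mul_pow, ← sq_abs]
    refine pow_le_pow_left₀ (abs_nonneg _) ?_ 2
    rw [← Real.norm_eq_abs, mul_comm]
    exact ContinuousLinearMap.le_opNorm _ _
  have hle : ∫ z, (fderiv ℝ θ z e) ^ 2 ≤ ‖e‖ ^ 2 * ∫ z, ‖fderiv ℝ θ z‖ ^ 2 := by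
    rw [← integral_const_mul]
    exact integral_mono_of_nonneg (Eventually.of_forall fun z => sq_nonneg _) (hint.const_mul _)
      (Eventually.of_forall hpt)
  calc r⁻¹ ^ 2 * (r ^ 3 * ∫ z, (fderiv ℝ θ z e) ^ 2)
      ≤ r⁻¹ ^ 2 * (r ^ 3 * (‖e‖ ^ 2 * ∫ z, ‖fderiv ℝ θ z‖ ^ 2)) := by gcongr
    _ = r * ‖e‖ ^ 2 * ∫ z, ‖fderiv ℝ θ z‖ ^ 2 := by field_simp

/-! ### Cauchy–Schwarz for a product -/

/-- **`|∫ F G| ≤ √(∫ F²) √(∫ G²)`** for `F, G ∈ L²(ℝ³)`. -/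
theorem fpl_abs_integral_mul_le_sqrt {F G : EuclideanSpace ℝ (Fin 3) → ℝ} (hF : MemLp F 2 volume)
    (hG : MemLp G 2 volume) :
    |∫ x, F x * G x| ≤ Real.sqrt (∫ x, F x ^ 2) * Real.sqrt (∫ x, G x ^ 2) := by
  have h1 : |∫ x, F x * G x| ≤ ∫ x, |F x| * |G x| := by
    refine (abs_integral_le_integral_abs).trans (le_of_eq ?_)
    exact integral_congr_ae (Eventually.of_forall fun x => abs_mul _ _)
  refine h1.trans ?_
  have hF' : MemLp (fun x => |F x|) (ENNReal.ofReal 2) volume := by rw [ENNReal.ofReal_ofNat]; exact hF.abs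
  have hG' : MemLp (fun x => |G x|) (ENNReal.ofReal 2) volume := by rw [ENNReal.ofReal_ofNat]; exact hG.abs
  have key := integral_mul_le_Lp_mul_Lq_of_nonneg Real.HolderConjugate.two_two
    (Eventually.of_forall fun x => abs_nonneg (F x)) (Eventually.of_forall fun x => abs_nonneg (G x)) hF' hG'
  refine key.trans (le_of_eq ?_)
  have eF : ∫ x, |F x| ^ (2 : ℝ) = ∫ x, F x ^ 2 :=
    integral_congr_ae (Eventually.of_forall fun x => by simp only [Real.rpow_two, sq_abs])
  have eG : ∫ x, |G x| ^ (2 : ℝ) = ∫ x, G x ^ 2 :=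
    integral_congr_ae (Eventually.of_forall fun x => by simp only [Real.rpow_two, sq_abs])
  rw [eF, eG, Real.sqrt_eq_rpow, Real.sqrt_eq_rpow]

/-! ### The scaled far-shell tail -/

/-- The substitution `y = r z` for the far-shell density, on the level of indicator functions:
`1_{|y|≥3r} ‖w y‖²|y|⁻⁴` at `y = r z` equals `r⁻⁴ 1_{|z|≥3} ‖w(rz)‖² |z|⁻⁴`. -/
theorem fpl_farShell_indicator_smul (w : EuclideanSpace ℝ (Fin 3) → EuclideanSpace ℝ (Fin 3)) {r : ℝ}
    (hr : 0 < r) (z : EuclideanSpace ℝ (Fin 3)) :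
    ((ball (0 : EuclideanSpace ℝ (Fin 3)) (3 * r))ᶜ.indicator (fun y => ‖w y‖ ^ 2 / ‖y‖ ^ 4)) (r • z) =
      (r ^ 4)⁻¹ * ((ball (0 : EuclideanSpace ℝ (Fin 3)) 3)ᶜ.indicator
        (fun z => ‖w (r • z)‖ ^ 2 / ‖z‖ ^ 4)) z := by
  have hmem : r • z ∈ (ball (0 : EuclideanSpace ℝ (Fin 3)) (3 * r))ᶜ ↔
      z ∈ (ball (0 : EuclideanSpace ℝ (Fin 3)) 3)ᶜ := by
    simp only [mem_compl_iff, mem_ball, dist_zero_right, norm_smul, Real.norm_of_nonneg hr.le, not_lt]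
    constructor
    · intro h; nlinarith
    · intro h; nlinarith
  by_cases hz : z ∈ (ball (0 : EuclideanSpace ℝ (Fin 3)) 3)ᶜ
  · rw [indicator_of_mem (hmem.2 hz), indicator_of_mem hz]
    have hz0 : 0 < ‖z‖ := by
      rw [mem_compl_iff, mem_ball, dist_zero_right, not_lt] at hz; linarith
    rw [norm_smul, Real.norm_of_nonneg hr.le, mul_pow, div_mul_eq_div_div_swap, div_div,
      eq_inv_mul_iff_mul_eq₀ (pow_ne_zero 4 hr.ne')]
    field_simp
  · rw [indicator_of_notMem (fun h => hz (hmem.1 h)), indicator_of_notMem hz, mul_zero]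

/-- **The far-shell tail at scale `r`**: there is an absolute `c_F ≥ 0` such that for every
continuous field `‖w‖ ≤ M` and every `r ≥ 1`, `y ↦ ‖w y‖² ‖y‖⁻⁴` is integrable off `B(0, 3r)` with
`∫_{|y| ≥ 3r} ‖w y‖² ‖y‖⁻⁴ dy ≤ c_F M² / r` (the landed `stub_fplFarShell` after `y = r z`). -/
theorem fpl_exists_farShell_scaled :
    ∃ c_F : ℝ, 0 ≤ c_F ∧ ∀ (w : EuclideanSpace ℝ (Fin 3) → EuclideanSpace ℝ (Fin 3)), Continuous w →
      ∀ (M : ℝ), (∀ y, ‖w y‖ ≤ M) → ∀ (r : ℝ), 1 ≤ r →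
      MeasureTheory.IntegrableOn (fun y => ‖w y‖ ^ 2 / ‖y‖ ^ 4)
          (Metric.ball (0 : EuclideanSpace ℝ (Fin 3)) (3 * r))ᶜ MeasureTheory.volume ∧
        ∫ y in (Metric.ball (0 : EuclideanSpace ℝ (Fin 3)) (3 * r))ᶜ, ‖w y‖ ^ 2 / ‖y‖ ^ 4 ≤
          c_F * M ^ 2 / r := by
  obtain ⟨cS, hcS0, hS⟩ := stub_fplFarShell
  have hcov : ∀ (ρ : ℝ), 1 ≤ ρ → ∀ (g : EuclideanSpace ℝ (Fin 3) → ℝ), Continuous g → (∀ x, 0 ≤ g x) →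
      ∀ (B : ℝ) (x₁ : EuclideanSpace ℝ (Fin 3)),
      (∀ z : EuclideanSpace ℝ (Fin 3), ∫ x in Metric.ball z 1, g x ≤ B) →
      ∫ x in Metric.ball x₁ ρ, g x ≤ 125 * ρ ^ 3 * B := stub_fplCovering
  set V : ℝ := (volume (ball (0 : EuclideanSpace ℝ (Fin 3)) 1)).toReal with hV
  have hV0 : 0 ≤ V := ENNReal.toReal_nonneg
  refine ⟨cS * V, by positivity, fun w hw M hM r hr => ?_⟩
  have hr0 : 0 < r := by linarith
  -- unit-scale shell bounds for the fields `z ↦ w (s z)`, `s = 1, r`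
  have hunit : ∀ s : ℝ, IntegrableOn (fun z => ‖w (s • z)‖ ^ 2 / ‖z - 0‖ ^ 4)
      (ball (0 : EuclideanSpace ℝ (Fin 3)) 3)ᶜ volume ∧
      ∫ z in (ball (0 : EuclideanSpace ℝ (Fin 3)) 3)ᶜ, ‖w (s • z)‖ ^ 2 / ‖z - 0‖ ^ 4 ≤ cS * (M ^ 2 * V) := by
    intro s
    have hsm : Continuous fun z : EuclideanSpace ℝ (Fin 3) => s • z := continuous_const_smul s
    have hws : Continuous fun z : EuclideanSpace ℝ (Fin 3) => w (s • z) := hw.comp hsm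
    have hgc : Continuous fun z : EuclideanSpace ℝ (Fin 3) => ‖w (s • z)‖ ^ 2 := hws.norm.pow 2
    have hpt : ∀ z : EuclideanSpace ℝ (Fin 3), ‖w (s • z)‖ ^ 2 ≤ M ^ 2 := fun z =>
      pow_le_pow_left₀ (norm_nonneg _) (hM _) 2
    have hB : ∀ z : EuclideanSpace ℝ (Fin 3), ∫ x in ball z 1, ‖w (s • x)‖ ^ 2 ≤ M ^ 2 * V := by
      intro z
      calc ∫ x in ball z 1, ‖w (s • x)‖ ^ 2 ≤ ∫ _x in ball z 1, M ^ 2 :=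
          integral_mono_of_nonneg (Eventually.of_forall fun x => sq_nonneg _)
            (integrableOn_const measure_ball_lt_top.ne) (Eventually.of_forall hpt)
        _ = M ^ 2 * V := by
          rw [setIntegral_const, smul_eq_mul, measureReal_def, Measure.addHaar_ball_center volume z 1, ← hV,
            mul_comm]
    exact hS hcov (fun z => ‖w (s • z)‖ ^ 2) hgc (fun z => sq_nonneg _) ⟨M ^ 2, hpt⟩ (M ^ 2 * V) 0 hB
  -- integrability off `B(0, 3r) ⊇ B(0, 3)`
  have hI1 := (hunit 1).1
  simp only [one_smul, sub_zero] at hI1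
  have hIntOn : IntegrableOn (fun y => ‖w y‖ ^ 2 / ‖y‖ ^ 4)
      (ball (0 : EuclideanSpace ℝ (Fin 3)) (3 * r))ᶜ volume :=
    hI1.mono_set (compl_subset_compl.2 (ball_subset_ball (by linarith)))
  refine ⟨hIntOn, ?_⟩
  -- the value after `y = r z`
  obtain ⟨-, hle⟩ := hunit r
  simp only [sub_zero] at hle
  have e1 : ∫ y in (ball (0 : EuclideanSpace ℝ (Fin 3)) (3 * r))ᶜ, ‖w y‖ ^ 2 / ‖y‖ ^ 4 =
      ∫ y, ((ball (0 : EuclideanSpace ℝ (Fin 3)) (3 * r))ᶜ.indicator (fun y => ‖w y‖ ^ 2 / ‖y‖ ^ 4)) y :=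
    (integral_indicator (measurableSet_ball.compl)).symm
  have e2 : ∫ y, ((ball (0 : EuclideanSpace ℝ (Fin 3)) (3 * r))ᶜ.indicator (fun y => ‖w y‖ ^ 2 / ‖y‖ ^ 4)) y =
      r ^ 3 * ∫ z, ((ball (0 : EuclideanSpace ℝ (Fin 3)) (3 * r))ᶜ.indicator
        (fun y => ‖w y‖ ^ 2 / ‖y‖ ^ 4)) (r • z) := by
    have h := Measure.integral_comp_smul_of_nonneg volume
      ((ball (0 : EuclideanSpace ℝ (Fin 3)) (3 * r))ᶜ.indicator (fun y => ‖w y‖ ^ 2 / ‖y‖ ^ 4)) r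
      (hR := hr0.le)
    rw [finrank_euclideanSpace_fin, smul_eq_mul] at h
    rw [h, ← mul_assoc, mul_inv_cancel₀ (pow_ne_zero 3 hr0.ne'), one_mul]
  have e3 : ∫ z, ((ball (0 : EuclideanSpace ℝ (Fin 3)) (3 * r))ᶜ.indicator
        (fun y => ‖w y‖ ^ 2 / ‖y‖ ^ 4)) (r • z) =
      (r ^ 4)⁻¹ * ∫ z in (ball (0 : EuclideanSpace ℝ (Fin 3)) 3)ᶜ, ‖w (r • z)‖ ^ 2 / ‖z‖ ^ 4 := by
    rw [← integral_indicator (measurableSet_ball.compl), ← integral_const_mul]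
    exact integral_congr_ae (Eventually.of_forall fun z => fpl_farShell_indicator_smul w hr0 z)
  rw [e1, e2, e3]
  have hr3 : r ^ 3 * (r ^ 4)⁻¹ = r⁻¹ := by
    rw [show r ^ 4 = r ^ 3 * r by ring, mul_inv, ← mul_assoc, mul_inv_cancel₀ (pow_ne_zero 3 hr0.ne'),
      one_mul]
  calc r ^ 3 * ((r ^ 4)⁻¹ * ∫ z in (ball (0 : EuclideanSpace ℝ (Fin 3)) 3)ᶜ, ‖w (r • z)‖ ^ 2 / ‖z‖ ^ 4)
      = r⁻¹ * ∫ z in (ball (0 : EuclideanSpace ℝ (Fin 3)) 3)ᶜ, ‖w (r • z)‖ ^ 2 / ‖z‖ ^ 4 := by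
        rw [← mul_assoc, hr3]
    _ ≤ r⁻¹ * (cS * (M ^ 2 * V)) := mul_le_mul_of_nonneg_left hle (inv_nonneg.2 hr0.le)
    _ = cS * V * M ^ 2 / r := by rw [div_eq_mul_inv]; ring

end Summit.NavierStokesRegularity.NavierStokesRegularity.Theorems

end
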